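import Summits.BirchSwinnertonDyer.BirchSwinnertonDyer.Theorems.PrintCf2RubinValueTwoFourTermCFTCharacters
import Summits.BirchSwinnertonDyer.BirchSwinnertonDyer.Theorems.PrintCf2RubinValueTwoFourTermCFTLayerTransport
import Mathlib.Topology.Algebra.ClopenNhdofOne
import HarnessLib

/-!
# The four-term sequence of class field theory at a finite level, X: the CHARACTER theorems of file VIII read on the
# subgroup `G_F = Gal(K̄/F) ≤ Γ_K` of a finite Galois layer `F ⊆ K̄`

Cell `bsd-print-cf2` (HOME `run/shared/lean/pub/bsd-print-cf2/`), seat `bsd-line-cf2c-w6` g4, brick §4(d)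
«four-term sequence `0 → Ē_∞ → U_v → 𝒳^{(v)} → A_∞ → 0` (CFT over `𝔎_∞L′`)» of LEAD memo
`Cruxes/SplitBadTwoRankOneOfFacts/RULING-B23-g13.md` §4, crux of record stmt-BirchSwinnertonDyer-24033
`PrintCf2RubinValueTwo.TwoVariableMainConjAtSplitTwoQuad`. Sequel to file IX (`…FourTermCFTLayerTransport`: the
homeomorphism `E.absGalEquiv : G_F ≃* Γ_F`, the prime/inertia transport `\bar ℤ_K ≅ \bar ℤ_F` and the dictionary
`forall_inertia_le_iff_forall_absGalEquiv_mem`). Here the two theorems of file VIII (`…FourTermCFTCharacters`) —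
«norm groups ⟹ characters» and «characters ⟹ norm groups» at the level `F` — are transported to characters of the
subgroup `G_F ≤ Γ_K` (subspace topology, inertia groups `G_F ∩ I_𝔓(Γ_K)` of the primes `𝔓` of `\bar ℤ_K` above places of
the BASE `K`), which is the currency of the (e)-assembler's Selmer groups (`subgroupH1`/`unramifiedOutside` over
`H ≤ Γ_K`; with `forall_primesAbove_inertia_iff_forall_conj` of file IX one passes further to
`GreenbergSelmer.inertia v` and its `Γ_K`-conjugates):

* `exists_absGaloisAbProj_absGalEquiv_eq` — Artin lifts exist in `G_F`;
* `absRestrictNormalHom_absGalEquiv_eq_abRestrict` — an Artin lift of `[a, F]` restricts to `ψ_{L|F}(a)` on every finite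
  abelian layer `L/F`;
* **`apply_eq_one_of_forall_mem_normGroup_of_absGalEquiv`** — if `a ∈ 𝒩_L` for every `p`-power abelian `L/F` unramified
  outside the places of `F` over `S₀`, every character of `G_F` into a finite `p`-group with open kernel killing the
  `G_F ∩ I_𝔓(Γ_K)`, `𝔓` over `v ∉ S₀`, kills every Artin lift of `[a, F]`;
* **`mem_normGroup_of_forall_absGalEquiv`** — the converse;
* the PROFINITE PLUMBING the pairing `u(m)(s) = s(rec m)` needs to move between `H′ = Gal(K̄/𝔎_∞)` and the layers
  `G_N`: `exists_monoidHom_sup_extend` (extend a character of `H` across a normal `O` it ignores),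
  `exists_subset_of_iInter_subset_of_isOpen` (compactness), `exists_openNormalSubgroup_forall_apply_eq_one`,
  **`exists_extension_to_layer`** (a character of `H′` with open kernel extends to some layer `G_N`, killed by an open
  normal subgroup) and **`exists_forall_mem_apply_eq_one`** (an extension to `G_{N₀}` killing `H′ ∩ C`, `C` closed —
  e.g. `I_𝔓̄(Γ_K)` — kills `G_N ∩ C` for `N ≫ N₀`: «`𝔎_∞` absorbs the ramification at `v̄`»).

No `sorry`, no definition, no named fact; Theses-free. No summit statement is proved; BSD is not advanced here.

## References
* [CasselsFrohlichANT1967] J. Tate, Ch. VII §5.1 (B), 5.4, §11.1. [NeukirchANT1999] Ch. I §9, Ch. IV §1, Ch. VI (6.6).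
* [deShalit1987] Ch. III §1.1–1.3 (the `X` of the four-term sequence).
-/

noncomputable section

set_option linter.dupNamespace false -- D-0017: single-problem summit, `…BirchSwinnertonDyer.BirchSwinnertonDyer…` repeats a namespace by design
set_option autoImplicit false

open Field NumberField IsDedekindDomain
open Literature.NumberTheory Literature.NumberTheory.NumberFields Literature.NumberTheory.GaloisRepresentations
  Literature.NumberTheory.GaloisRepresentations.IdeleClassBar

namespace Summit.BirchSwinnertonDyer.BirchSwinnertonDyer.Theorems.PrintCf2.FourTermCFT

variable {K : Type} [Field K] (E : GalLayer K)

/-! ### The character theorems of file VIII on `G_F ≤ Γ_K` -/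

/-- **Artin lifts exist in `G_F`**: every element of `Γ_F^ab` (e.g. `[a, F] = ideleArtinMap F a`) is
`absGalEquiv u |_{F^ab}` for some `u ∈ G_F = Gal(K̄/F)`. [cite: CasselsFrohlichANT1967, Ch. VII §5.1] -/
theorem exists_absGaloisAbProj_absGalEquiv_eq (x : absoluteGaloisGroupAbelianization E.1) :
    ∃ u : (E.openNormalSubgroup : Subgroup (absoluteGaloisGroup K)),
      absGaloisAbProj E.1 (E.absGalEquiv u) = x := by
  obtain ⟨γ, rfl⟩ := QuotientGroup.mk_surjective x
  obtain ⟨u, rfl⟩ := E.absGalEquiv.surjective γ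
  exact ⟨u, rfl⟩

/-- Reading an Artin lift on a finite abelian layer `L/F`: if `absGalEquiv u |_{F^ab} = [a, F]` then
`absGalEquiv u |_L = [a, F]|_L = ψ_{L|F}(a)` (`abRestrict_absGaloisAbProj`). [cite: CasselsFrohlichANT1967, Ch. VII 5.4] -/
theorem absRestrictNormalHom_absGalEquiv_eq_abRestrict [NumberField E.1]
    (L : IntermediateField E.1 (AlgebraicClosure E.1)) [FiniteDimensional E.1 L] [IsAbelianGalois E.1 L]
    {u : (E.openNormalSubgroup : Subgroup (absoluteGaloisGroup K))} {a : ideleGroup E.1}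
    (hu : absGaloisAbProj E.1 (E.absGalEquiv u) = ideleArtinMap E.1 a) :
    absRestrictNormalHom L (E.absGalEquiv u) = abRestrict L (ideleArtinMap E.1 a) := by
  rw [← hu, abRestrict_absGaloisAbProj]

/-- **NORM GROUPS ⟹ CHARACTERS, on `G_F ≤ Γ_K`.** Let `S` be the places of `F` over `S₀` and `a ∈ 𝕀_F` a norm from
every finite abelian `p`-power layer of `F` unramified outside `S`. Then every character `χ : G_F → A` into a finite
`p`-group with open kernel (subspace topology of `Γ_K`) which kills `G_F ∩ I_𝔓(Γ_K)` for every prime `𝔓` of `\bar ℤ_K`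
above a place `v ∉ S₀` of `K` kills every `u ∈ G_F` with `absGalEquiv u |_{F^ab} = [a, F]` (file VIII transported
along the homeomorphism `absGalEquiv` and §3). [cite: CasselsFrohlichANT1967, Ch. VII §5.1 (B), 5.4]
[cite: NeukirchANT1999, Ch. VI (6.6), Ch. I §9] -/
theorem apply_eq_one_of_forall_mem_normGroup_of_absGalEquiv [NumberField E.1] {p : ℕ} [Fact p.Prime]
    (S₀ : Finset (HeightOneSpectrum (𝓞 K))) (S : Finset (HeightOneSpectrum (𝓞 E.1)))
    (hS : ∀ w : HeightOneSpectrum (𝓞 E.1), w ∈ S ↔ w.under (𝓞 K) ∈ S₀) (a : ideleGroup E.1)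
    (ha : ∀ (L : IntermediateField E.1 (AlgebraicClosure E.1)) [FiniteDimensional E.1 L] [IsAbelianGalois E.1 L]
      [NumberField L], (∃ n, Module.finrank E.1 L = p ^ n) →
      (∀ w : HeightOneSpectrum (𝓞 E.1), w ∉ S → Algebra.IsUnramifiedIn (𝓞 L) w.asIdeal) →
      a ∈ Automorphic.normGroup E.1 L)
    {A : Type*} [CommGroup A] [Finite A] (hA : IsPGroup p A)
    (χ : (E.openNormalSubgroup : Subgroup (absoluteGaloisGroup K)) →* A)
    (hχ : IsOpen (χ.ker : Set (E.openNormalSubgroup : Subgroup (absoluteGaloisGroup K))))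
    (hunr : ∀ v : HeightOneSpectrum (𝓞 K), v ∉ S₀ → ∀ 𝔓 ∈ v.primesAbove,
      ∀ u : (E.openNormalSubgroup : Subgroup (absoluteGaloisGroup K)),
        (u : absoluteGaloisGroup K) ∈ 𝔓.inertia (absoluteGaloisGroup K) → χ u = 1)
    (u : (E.openNormalSubgroup : Subgroup (absoluteGaloisGroup K)))
    (hu : absGaloisAbProj E.1 (E.absGalEquiv u) = ideleArtinMap E.1 a) : χ u = 1 := by
  let χ' : absoluteGaloisGroup E.1 →* A := χ.comp E.absGalEquiv.symm.toMonoidHom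
  have hχ' : IsOpen (χ'.ker : Set (absoluteGaloisGroup E.1)) := by
    have : (χ'.ker : Set (absoluteGaloisGroup E.1)) = E.absGalEquiv.symm ⁻¹' (χ.ker : Set _) := by
      ext γ
      simp only [SetLike.mem_coe, MonoidHom.mem_ker, Set.mem_preimage, χ', MonoidHom.comp_apply,
        MulEquiv.coe_toMonoidHom]
    rw [this]
    exact hχ.preimage (continuous_absGalEquiv_symm E)
  have hunr' : ∀ w : HeightOneSpectrum (𝓞 E.1), w ∉ S → ∀ 𝔔 ∈ w.primesAbove,
      ∀ g ∈ 𝔔.inertia (absoluteGaloisGroup E.1), χ' g = 1 := by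
    have h := (forall_inertia_le_iff_forall_absGalEquiv_mem (E := E) (↑S₀ : Set (HeightOneSpectrum (𝓞 K))) χ'.ker).2
      (fun v hv 𝔓 h𝔓 u hu => by
        rw [MonoidHom.mem_ker]
        simpa [χ'] using hunr v (fun h => hv (Finset.mem_coe.2 h)) 𝔓 h𝔓 u hu)
    intro w hw 𝔔 h𝔔 g hg
    exact (MonoidHom.mem_ker).1 (h w (fun h' => hw ((hS w).2 (Finset.mem_coe.1 h'))) 𝔔 h𝔔 hg)
  have key := apply_eq_one_of_forall_mem_normGroup S a ha hA χ' hχ' hunr' (E.absGalEquiv u) hu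
  simpa [χ'] using key

/-- **CHARACTERS ⟹ NORM GROUPS, on `G_F ≤ Γ_K`.** Conversely: if for every finite abelian `p`-power layer `L/F` whose
restriction `r_L ∘ absGalEquiv : G_F → G(L|F)` kills `G_F ∩ I_𝔓(Γ_K)` for all `𝔓` above places `v ∉ S₀` of `K`, that
restriction kills every `u ∈ G_F` with `absGalEquiv u |_{F^ab} = [a, F]`, then `a ∈ 𝒩_L` for every such `L` unramified
outside the places of `F` over `S₀`. [cite: CasselsFrohlichANT1967, Ch. VII §5.1 (B), 5.4] [cite: NeukirchANT1999, Ch. VI (6.6)] -/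
theorem mem_normGroup_of_forall_absGalEquiv [NumberField E.1] {p : ℕ}
    (S₀ : Finset (HeightOneSpectrum (𝓞 K))) (S : Finset (HeightOneSpectrum (𝓞 E.1)))
    (hS : ∀ w : HeightOneSpectrum (𝓞 E.1), w ∈ S ↔ w.under (𝓞 K) ∈ S₀) (a : ideleGroup E.1)
    (h : ∀ (L : IntermediateField E.1 (AlgebraicClosure E.1)) [FiniteDimensional E.1 L] [IsAbelianGalois E.1 L],
      (∃ n, Module.finrank E.1 L = p ^ n) →
      (∀ v : HeightOneSpectrum (𝓞 K), v ∉ S₀ → ∀ 𝔓 ∈ v.primesAbove,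
        ∀ u : (E.openNormalSubgroup : Subgroup (absoluteGaloisGroup K)),
          (u : absoluteGaloisGroup K) ∈ 𝔓.inertia (absoluteGaloisGroup K) →
          absRestrictNormalHom L (E.absGalEquiv u) = 1) →
      ∀ u : (E.openNormalSubgroup : Subgroup (absoluteGaloisGroup K)),
        absGaloisAbProj E.1 (E.absGalEquiv u) = ideleArtinMap E.1 a → absRestrictNormalHom L (E.absGalEquiv u) = 1)
    (L : IntermediateField E.1 (AlgebraicClosure E.1)) [FiniteDimensional E.1 L] [IsAbelianGalois E.1 L]
    [NumberField L] (hdeg : ∃ n, Module.finrank E.1 L = p ^ n)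
    (hunr : ∀ w : HeightOneSpectrum (𝓞 E.1), w ∉ S → Algebra.IsUnramifiedIn (𝓞 L) w.asIdeal) :
    a ∈ Automorphic.normGroup E.1 L := by
  refine mem_normGroup_of_forall_absRestrictNormalHom_eq_one S a (fun L' _ _ hdeg' hI γ hγ => ?_) L hdeg hunr
  obtain ⟨u, rfl⟩ := E.absGalEquiv.surjective γ
  refine h L' hdeg' ?_ u hγ
  have hI' := (forall_inertia_le_iff_forall_absGalEquiv_mem (E := E) (↑S₀ : Set (HeightOneSpectrum (𝓞 K)))
    (absRestrictNormalHom L').ker).1 (fun w hw 𝔔 h𝔔 g hg =>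
      (MonoidHom.mem_ker).2 (hI w (fun h' => hw (Finset.mem_coe.2 ((hS w).1 h'))) 𝔔 h𝔔 g hg))
  intro v hv 𝔓 h𝔓 u' hu'
  exact (MonoidHom.mem_ker).1 (hI' v (fun h' => hv (Finset.mem_coe.1 h')) 𝔓 h𝔓 u' hu')


/-! ### Profinite plumbing for the (e)-pairing: from `H′ = Gal(K̄/𝔎_∞)` to the layers `G_N = Gal(K̄/F_N)` -/

section Profinite

variable {Γ : Type*} [Group Γ] {A : Type*} [CommGroup A]

/-- **Extending a character across a normal subgroup it ignores**: for `H, O ≤ Γ` with `O` normal and `f : H → A`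
(`A` commutative) trivial on `H ∩ O`, there is `F : H ⊔ O = H·O → A` extending `f` and trivial on `O` (second
isomorphism theorem `H/(H ∩ O) ≅ HO/O`). In the pairing: `H = H′`, `O` an open normal subgroup of `Γ_K` inside the
kernel of the Selmer class. [cite: NeukirchANT1999, Ch. IV §1] -/
theorem exists_monoidHom_sup_extend (H O : Subgroup Γ) [O.Normal] (f : H →* A)
    (hf : ∀ h : H, (h : Γ) ∈ O → f h = 1) :
    ∃ F : (H ⊔ O : Subgroup Γ) →* A,
      (∀ h : H, F (Subgroup.inclusion le_sup_left h) = f h) ∧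
      ∀ g : (H ⊔ O : Subgroup Γ), (g : Γ) ∈ O → F g = 1 := by
  classical
  have hker : O.subgroupOf H ≤ f.ker := fun h hh => by
    rw [MonoidHom.mem_ker]; exact hf h (Subgroup.mem_subgroupOf.1 hh)
  let f₁ : H ⧸ O.subgroupOf H →* A := QuotientGroup.lift _ f hker
  let e := QuotientGroup.quotientInfEquivProdNormalQuotient H O
  let F : (H ⊔ O : Subgroup Γ) →* A :=
    (f₁.comp e.symm.toMonoidHom).comp (QuotientGroup.mk' (O.subgroupOf (H ⊔ O)))
  have he : ∀ h : H, e (QuotientGroup.mk h) = QuotientGroup.mk (Subgroup.inclusion le_sup_left h) :=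
    fun h => rfl
  refine ⟨F, fun h => ?_, fun g hg => ?_⟩
  · simp only [F, MonoidHom.comp_apply, QuotientGroup.mk'_apply, MulEquiv.coe_toMonoidHom]
    rw [← he, MulEquiv.symm_apply_apply]
    rfl
  · simp only [F, MonoidHom.comp_apply, QuotientGroup.mk'_apply, MulEquiv.coe_toMonoidHom]
    have : (QuotientGroup.mk g : (H ⊔ O : Subgroup Γ) ⧸ O.subgroupOf (H ⊔ O)) = 1 := by
      rw [QuotientGroup.eq_one_iff]
      exact Subgroup.mem_subgroupOf.2 hg
    rw [this, map_one, map_one]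

/-- **Compactness**: in a compact space, an antitone (directed) family of closed sets whose intersection lies in an
open set `U` has a member inside `U` (Mathlib `IsCompact.elim_directed_family_closed` applied to `Uᶜ`). In the pairing:
`A_n = G_n = Gal(K̄/F_n)` (or `G_n ∩ I_𝔓`), `⋂ A_n = H′` (or `H′ ∩ I_𝔓`). [cite: NeukirchANT1999, Ch. IV §1 (1.2)] -/
theorem exists_subset_of_iInter_subset_of_isOpen {X : Type*} [TopologicalSpace X] [CompactSpace X]
    {ι : Type*} [Preorder ι] [IsDirected ι (· ≤ ·)] [Nonempty ι]
    {A : ι → Set X} (hA : Antitone A) (hcl : ∀ i, IsClosed (A i)) {U : Set X} (hU : IsOpen U)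
    (h : ⋂ i, A i ⊆ U) : ∃ i, A i ⊆ U := by
  have h0 : Uᶜ ∩ ⋂ i, A i = ∅ := by
    rw [← Set.subset_empty_iff]
    rintro x ⟨hxU, hxA⟩
    exact hxU (h hxA)
  obtain ⟨i, hi⟩ := (hU.isClosed_compl.isCompact).elim_directed_family_closed A hcl h0 hA.directed_ge
  refine ⟨i, fun x hx => ?_⟩
  by_contra hxU
  have : x ∈ Uᶜ ∩ A i := ⟨hxU, hx⟩
  rw [hi] at this
  exact this

variable [TopologicalSpace Γ] [IsTopologicalGroup Γ] [CompactSpace Γ]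

/-- **An open kernel in a subgroup is cut out by an open normal subgroup of the ambient profinite group**: for
`f : H → A` with `ker f` open in the subspace topology there is an open normal `O ⊴ Γ` with `f(H ∩ O) = 1`.
[cite: NeukirchANT1999, Ch. IV §1 (1.2)] -/
theorem exists_openNormalSubgroup_forall_apply_eq_one [TotallyDisconnectedSpace Γ]
    {H : Subgroup Γ} (f : H →* A) (hf : IsOpen (f.ker : Set H)) :
    ∃ O : OpenNormalSubgroup Γ, ∀ h : H, (h : Γ) ∈ (O : Subgroup Γ) → f h = 1 := by
  obtain ⟨V, hV, hVker⟩ := isOpen_induced_iff.1 hf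
  have h1V : (1 : Γ) ∈ V := by
    have : (1 : H) ∈ Subtype.val ⁻¹' V := by rw [hVker]; exact one_mem f.ker
    simpa using this
  obtain ⟨O, hO⟩ := ProfiniteGrp.exist_openNormalSubgroup_sub_open_nhds_of_one hV h1V
  refine ⟨O, fun h hh => ?_⟩
  have : h ∈ (Subtype.val ⁻¹' V : Set H) := hO hh
  rw [hVker] at this
  exact this

/-- **Factoring a character of `H′` through a layer.** Let `G_n` be an antitone sequence of closed subgroups of the
profinite group `Γ` with `H ≤ G_n` and `⨅ G_n ≤ H` (the layers `Gal(K̄/F_n)` of a tower exhausting `𝔎_∞ = K̄^{H′}`), and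
`f : H → A` a character with open kernel. Then for some `N`, `f` extends to a character `F` of `G_N` trivial on an open
normal subgroup `O` of `Γ` (so with open kernel): `f(H ∩ O) = 1` for an open normal `O`, `G_N ≤ H·O` for `N ≫ 0` by
compactness, and `F = f̄|_{G_N}` for the extension `f̄` of `f` to `H·O`. This is the step «a finite-order character of
`Gal(M_∞/𝔎_∞)` comes from a finite level» of the (e)-pairing. [cite: deShalit1987, Ch. III §1.1–1.3]
[cite: NeukirchANT1999, Ch. IV §1 (1.2)] -/
theorem exists_extension_to_layer [TotallyDisconnectedSpace Γ] {H : Subgroup Γ} {G : ℕ → Subgroup Γ}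
    (hG : Antitone G) (hcl : ∀ n, IsClosed (G n : Set Γ)) (hHG : ∀ n, H ≤ G n) (hGH : ⨅ n, G n ≤ H)
    (f : H →* A) (hf : IsOpen (f.ker : Set H)) :
    ∃ (N : ℕ) (F : G N →* A) (O : OpenNormalSubgroup Γ),
      (∀ h : H, F (Subgroup.inclusion (hHG N) h) = f h) ∧
      ∀ g : G N, (g : Γ) ∈ (O : Subgroup Γ) → F g = 1 := by
  obtain ⟨O, hO⟩ := exists_openNormalSubgroup_forall_apply_eq_one f hf
  obtain ⟨F₀, hF₀H, hF₀O⟩ := exists_monoidHom_sup_extend H (O : Subgroup Γ) f hO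
  have hopen : IsOpen ((H ⊔ (O : Subgroup Γ) : Subgroup Γ) : Set Γ) :=
    Subgroup.isOpen_mono le_sup_right O.isOpen
  have hsub : ⋂ n, (G n : Set Γ) ⊆ ((H ⊔ (O : Subgroup Γ) : Subgroup Γ) : Set Γ) := by
    intro x hx
    have hx' : x ∈ ⨅ n, G n := Subgroup.mem_iInf.2 fun n => Set.mem_iInter.1 hx n
    exact (le_sup_left : H ≤ H ⊔ (O : Subgroup Γ)) (hGH hx')
  obtain ⟨N, hN⟩ := exists_subset_of_iInter_subset_of_isOpen
    (fun m n hmn => (hG hmn : (G n : Set Γ) ⊆ G m)) hcl hopen hsub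
  exact ⟨N, F₀.comp (Subgroup.inclusion fun x hx => hN hx), O, fun h => hF₀H h, fun g hg => hF₀O _ hg⟩

omit [IsTopologicalGroup Γ] in
/-- **Deep layers kill what `H′` kills.** In the same tower, let `F : G_{N₀} → A` have open kernel and kill `H ∩ C` for
a closed `C ⊆ Γ`. Then for `N ≫ N₀`, `F` kills `G_N ∩ C` (compactness: `⋂_N (G_N ∩ C) = H ∩ C` lies in the open set
`ker F ∪ G_{N₀}ᶜ`). With `C = I_𝔓̄(Γ_K)`: an extension to `G_{N₀}` of a Selmer class of `H′` (unramified at `v̄`) becomes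
unramified at `v̄` on the deep layers `G_N` — the «`𝔎_∞` absorbs the ramification at `v̄`» step of the (e)-pairing
(de Shalit's four-term sequence over `𝔎_∞L′`). [cite: deShalit1987, Ch. III §1.1–1.3] [cite: NeukirchANT1999, Ch. IV §1 (1.2)] -/
theorem exists_forall_mem_apply_eq_one {H : Subgroup Γ} {G : ℕ → Subgroup Γ}
    (hG : Antitone G) (hcl : ∀ n, IsClosed (G n : Set Γ)) (hHG : ∀ n, H ≤ G n) (hGH : ⨅ n, G n ≤ H)
    {C : Set Γ} (hC : IsClosed C) {N₀ : ℕ} (F : G N₀ →* A) (hF : IsOpen (F.ker : Set (G N₀)))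
    (hFC : ∀ h : H, (h : Γ) ∈ C → F (Subgroup.inclusion (hHG N₀) h) = 1) :
    ∃ N, ∃ hN : N₀ ≤ N, ∀ g : G N, (g : Γ) ∈ C → F (Subgroup.inclusion (hG hN) g) = 1 := by
  obtain ⟨V, hV, hVker⟩ := isOpen_induced_iff.1 hF
  let U : Set Γ := V ∪ (G N₀ : Set Γ)ᶜ
  have hU : IsOpen U := hV.union (hcl N₀).isOpen_compl
  have hsub : ⋂ n, ((G n : Set Γ) ∩ C) ⊆ U := by
    intro x hx
    rw [Set.mem_iInter] at hx
    have hxH : x ∈ H := hGH (Subgroup.mem_iInf.2 fun n => (hx n).1)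
    have hker : (Subgroup.inclusion (hHG N₀) ⟨x, hxH⟩) ∈ (F.ker : Set (G N₀)) := hFC ⟨x, hxH⟩ (hx N₀).2
    rw [← hVker] at hker
    exact Or.inl hker
  obtain ⟨N, hN⟩ := exists_subset_of_iInter_subset_of_isOpen
    (fun m n hmn => Set.inter_subset_inter_left C (hG hmn : (G n : Set Γ) ⊆ G m))
    (fun n => (hcl n).inter hC) hU hsub
  refine ⟨max N₀ N, le_max_left _ _, fun g hg => ?_⟩
  have hg₀ : (g : Γ) ∈ G N₀ := hG (le_max_left N₀ N) g.2
  rcases hN ⟨hG (le_max_right N₀ N) g.2, hg⟩ with hgV | hgc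
  · have : (Subgroup.inclusion (hG (le_max_left N₀ N)) g) ∈ (Subtype.val ⁻¹' V : Set (G N₀)) := hgV
    rw [hVker] at this
    exact this
  · exact absurd hg₀ hgc

end Profinite

end Summit.BirchSwinnertonDyer.BirchSwinnertonDyer.Theorems.PrintCf2.FourTermCFT

end
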